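import Literature.NumberTheory.QuadraticFields.ThreeTorsionMean
import Literature.NumberTheory.QuadraticFields.FundamentalDiscriminant
import HarnessLib

/-!
# Fundamental discriminants are cut out by local conditions at every prime (the sets `𝒱_p` of Davenport–Heilbronn / Bhargava–Varma)

Topic `NumberTheory/QuadraticFields`. Bhargava–Varma 2016, §3: "It is well known that a quadratic
ring `𝒪` is maximal if and only if the odd part of the discriminant of `𝒪` is squarefree, and
`disc(𝒪) ≡ 1, 5, 8, 9, 12, or 13 (mod 16)`. We therefore define for every prime `p`:
`𝒱_p := {f : disc(f) ≡ 1,5,8,9,12,13 (mod 16)}` if `p = 2`; `{f : disc_p(f) is squarefree}` if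
`p ≠ 2` … If we set `𝒱 := ∩_p 𝒱_p`, then `𝒱` is the set of forms … for which the ring `𝒪` … is
a maximal quadratic ring" (the same sets in BST §8.2: "`𝒵_p` consists of those binary cubic forms
whose discriminants are not fundamental [at `p`]"). As conditions on the integer `D = disc`:

* `IsFundAt p D` — `p = 2`: `D ≡ 1 (mod 4)` or `D ≡ 8, 12 (mod 16)`; `p` odd: `p² ∤ D`;
* `isFundamental_iff_forall_isFundAt` — **`D` is a fundamental discriminant iff `D ≠ 1` and
  `IsFundAt p D` for every prime `p`** (the tree's spelling of "fundamental", as in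
  `negFundDiscrs` / `posFundDiscrs` of `ThreeTorsionMean.lean`);
* `negFundDiscrs_eq_filter`, `posFundDiscrs_eq_filter_erase` — the finsets of
  `ThreeTorsionMean.lean` as the negative / positive integers in the window satisfying all local
  conditions (on the positive side, minus `D = 1`);
* `isFundAt_of_sq_lt` — for `p` odd with `|D| < p²`, `D ≠ 0`, the condition at `p` holds (only
  finitely many primes matter below a given height).

Everything is proved.

## References

* M. Bhargava, I. Varma, Proc. LMS 112 (2016) = arXiv:1401.5875, §3 (the sets 𝒱_p)
  [BhargavaVarma2016].
* M. Bhargava, A. Shankar, J. Tsimerman, Invent. Math. 193 (2013), §8.2 [BhargavaShankarTsimerman2012].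
-/

namespace Literature.NumberTheory.QuadraticFields

open Finset

/-- **The local condition at `p` for an integer to be a fundamental discriminant** (`𝒱_p` of
Bhargava–Varma §3 on discriminants): at `p = 2`, `D ≡ 1 (mod 4)` or `D ≡ 8, 12 (mod 16)`;
at odd `p`, `p² ∤ D`. [cite: BhargavaVarma2016, §3 (definition of 𝒱_p)] -/
def IsFundAt (p : ℕ) (D : ℤ) : Prop :=
  if p = 2 then D % 4 = 1 ∨ D % 16 = 8 ∨ D % 16 = 12 else ¬ ((p : ℤ) ^ 2 ∣ D)

/-- At `2`. [folklore] -/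
theorem isFundAt_two {D : ℤ} : IsFundAt 2 D ↔ D % 4 = 1 ∨ D % 16 = 8 ∨ D % 16 = 12 := by
  simp [IsFundAt]

/-- At odd `p`. [folklore] -/
theorem isFundAt_of_ne_two {p : ℕ} (hp : p ≠ 2) {D : ℤ} : IsFundAt p D ↔ ¬ ((p : ℤ) ^ 2 ∣ D) := by
  simp [IsFundAt, hp]

/-- **Fundamental ⟺ locally fundamental everywhere and `≠ 1`.** [cite: BhargavaVarma2016, §3 (a quadratic ring is maximal iff the odd part of its discriminant is squarefree and disc ≡ 1,5,8,9,12,13 (mod 16))] -/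
theorem isFundamental_iff_forall_isFundAt (D : ℤ) :
    ((D % 4 = 1 ∧ Squarefree D ∧ D ≠ 1) ∨ (4 ∣ D ∧ (D / 4 % 4 = 2 ∨ D / 4 % 4 = 3) ∧ Squarefree (D / 4)))
      ↔ D ≠ 1 ∧ ∀ p : ℕ, p.Prime → IsFundAt p D := by
  constructor
  · intro hD
    refine ⟨?_, fun p hp => ?_⟩
    · rcases hD with ⟨-, -, h1⟩ | ⟨h4, -, -⟩
      · exact h1
      · omega
    · by_cases hp2 : p = 2
      · subst hp2
        rw [isFundAt_two]
        rcases hD with ⟨h1, -, -⟩ | ⟨h4, hm, -⟩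
        · exact Or.inl h1
        · right; omega
      · rw [isFundAt_of_ne_two hp2]
        intro hdvd
        rcases Quadratic.sq_eq_one_or_four_of_sq_dvd hD hdvd with h | h
        · have : (p : ℤ) = 1 := by nlinarith [show (0 : ℤ) ≤ p from Int.natCast_nonneg p]
          exact hp.one_lt.ne' (by exact_mod_cast this)
        · have : (p : ℤ) = 2 := by nlinarith [show (0 : ℤ) ≤ p from Int.natCast_nonneg p]
          exact hp2 (by exact_mod_cast this)
  · rintro ⟨h1, hloc⟩
    have h2 := (isFundAt_two).mp (hloc 2 Nat.prime_two)
    have hodd : ∀ p : ℕ, p.Prime → p ≠ 2 → ¬ ((p : ℤ) ^ 2 ∣ D) := fun p hp hp2 =>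
      (isFundAt_of_ne_two hp2).mp (hloc p hp)
    rcases h2 with h | h | h
    · left
      refine ⟨h, Int.squarefree_of_forall_prime_sq_not_dvd fun p hp hdvd => ?_, h1⟩
      by_cases hp2 : p = 2
      · subst hp2; omega
      · exact hodd p hp hp2 hdvd
    · right
      refine ⟨by omega, by omega, Int.squarefree_of_forall_prime_sq_not_dvd fun p hp hdvd => ?_⟩
      by_cases hp2 : p = 2
      · subst hp2; omega
      · exact hodd p hp hp2 (hdvd.trans (Int.ediv_dvd_of_dvd (by omega)))
    · right
      refine ⟨by omega, by omega, Int.squarefree_of_forall_prime_sq_not_dvd fun p hp hdvd => ?_⟩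
      by_cases hp2 : p = 2
      · subst hp2; omega
      · exact hodd p hp hp2 (hdvd.trans (Int.ediv_dvd_of_dvd (by omega)))

/-- Below height `p²` (odd `p`) the local condition at `p` is automatic for `D ≠ 0`. [folklore] -/
theorem isFundAt_of_sq_lt {p : ℕ} (hp2 : p ≠ 2) {D : ℤ} (hD0 : D ≠ 0) (hlt : |D| < (p : ℤ) ^ 2) :
    IsFundAt p D := by
  rw [isFundAt_of_ne_two hp2]
  intro hdvd
  have := Int.le_of_dvd (abs_pos.mpr hD0) ((dvd_abs _ _).mpr hdvd)
  omega

/-- `negFundDiscrs X` = the `D ∈ (−X, 0)` locally fundamental at every prime. [folklore] -/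
theorem negFundDiscrs_eq_filter (X : ℕ) [DecidablePred fun D : ℤ => ∀ p : ℕ, p.Prime → IsFundAt p D] :
    negFundDiscrs X = (Finset.Ioo (-(X : ℤ)) 0).filter fun D => ∀ p : ℕ, p.Prime → IsFundAt p D := by
  ext D
  rw [mem_negFundDiscrs, Finset.mem_filter, Finset.mem_Ioo, isFundamental_iff_forall_isFundAt]
  constructor
  · rintro ⟨hI, -, h⟩; exact ⟨hI, h⟩
  · rintro ⟨hI, h⟩; exact ⟨hI, by omega, h⟩

/-- `posFundDiscrs X` = the `D ∈ (0, X)` locally fundamental at every prime, except `D = 1`.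
[folklore] -/
theorem posFundDiscrs_eq_filter_erase (X : ℕ) [DecidablePred fun D : ℤ => ∀ p : ℕ, p.Prime → IsFundAt p D] :
    posFundDiscrs X = ((Finset.Ioo (0 : ℤ) X).filter fun D => ∀ p : ℕ, p.Prime → IsFundAt p D).erase 1 := by
  ext D
  rw [mem_posFundDiscrs, Finset.mem_erase, Finset.mem_filter, Finset.mem_Ioo, isFundamental_iff_forall_isFundAt]
  constructor
  · rintro ⟨hI, h1, h⟩; exact ⟨h1, hI, h⟩
  · rintro ⟨h1, hI, h⟩; exact ⟨hI, h1, h⟩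

/-- `1` satisfies every local condition. [folklore] -/
theorem isFundAt_one (p : ℕ) (hp : p.Prime) : IsFundAt p 1 := by
  by_cases hp2 : p = 2
  · subst hp2; rw [isFundAt_two]; left; rfl
  · rw [isFundAt_of_ne_two hp2]
    intro h
    have := Int.eq_one_of_dvd_one (by positivity) h
    have hp1 : (p : ℤ) ^ 2 = 1 := this
    have : (p : ℤ) = 1 := by nlinarith [show (0 : ℤ) ≤ p from Int.natCast_nonneg p]
    exact hp.one_lt.ne' (by exact_mod_cast this)

end Literature.NumberTheory.QuadraticFields
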